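import Summits.RiemannHypothesis.RiemannHypothesis.Theorems.ThetaTier1ChebBridge
import HarnessLib

/-!
# THETA tier-1 — the BRIDGE for the Chebyshev-variant checker, main theorems (RS-free; cc-s2-1, WEIL typing lane; RH-FREE)

From `ThetaTier1ChebBridge` (`lossCheb_le`, `chebN_ge`), `ThetaTier1BridgeMain` (`gain_le`-style gain side, `admissible_of_conds`,
`zetaHyp_four`, `lambdaHyp_four`): for a row certified by the RS-free checker `checkAllCheb`,

* `lossCheb_lt_gain_of_realCertCheb (hq) (hc : r.RealCertCheb) (hZ) (hΛ) (hχ) (hR) :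
  (ofRow r).Admissible r.qn ∧ Real.exp 2 ≤ (ofRow r).chebN ∧ (ofRow r).lossCheb (1/2^r.k) < (ofRow r).gain 16`;
* `lossCheb_lt_gain_of_realCertCheb_four (hm : r.m = 4) (hq) (hc : r.RealCertCheb)` — HYPOTHESIS-FREE — and `…_of_checkAllCheb_four`.

The RS-free (AN) theorem (cc-s2-3, with handoff-prove-2's `vonMangoldt_logTail_sum_le_cheb`) consumes exactly this triple.
Nothing here bears on the truth of RH.
-/

set_option linter.dupNamespace false  -- the mandated namespace repeats `RiemannHypothesis`
set_option autoImplicit false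

namespace Summit.RiemannHypothesis.RiemannHypothesis.Theorems.ThetaTier1

open Summit.RiemannHypothesis.RiemannHypothesis.Theorems.WeilColumn.ThetaMellin

noncomputable section

/-- `r.gainCheb ≤ P.gain 16` (the gain register of the variant is `2 I_lo log q` as before). [this cell] -/
theorem gainCheb_le (r : Row) (hq : 2 ≤ r.q) (hR : RtopHyp r) : r.gainCheb ≤ (ofRow r).gain JSTEPS := by
  obtain ⟨-, -, -, -, -, -, -, -, -, -, -, -, -, -, -, -, -, -, -, h19, -⟩ := r.vals_table
  rw [r.lossCheb_gainCheb.2, r.envCheb_39, h19, ThetaParams.gain, Ilo_eq r hR, ofRow_q]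
  have hl : 0 ≤ Real.log r.q := Real.log_nonneg (by exact_mod_cast (by omega : 1 ≤ r.q))
  have hI : ((r.Ilo : ℚ) : ℝ) ≤ ((r.IloExact : ℚ) : ℝ) := by exact_mod_cast r.Ilo_le_IloExact
  push_cast
  nlinarith

/-- **(AR), RS-free**: a row certified by `checkAllCheb` gives `Admissible ∧ e² ≤ N ∧ lossCheb (2^{-k}) < gain 16` over
`ThetaParams`, modulo the four named hypotheses. [this cell, THETA-ASSIGN §2 / ATTEMPT-22 §5] -/
theorem lossCheb_lt_gain_of_realCertCheb (r : Row) (hq : 2 ≤ r.q) (hc : r.RealCertCheb) (hZ : ZetaHyp r.m)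
    (hΛ : LambdaHyp r.m) (hχ : ChiHyp r) (hR : RtopHyp r) :
    (ofRow r).Admissible r.qn ∧ Real.exp 2 ≤ (ofRow r).chebN ∧ (ofRow r).lossCheb (1 / 2 ^ r.k) < (ofRow r).gain JSTEPS := by
  have hc' := hc
  obtain ⟨-, hm4, -, hd, heps, hwin, he2, -, hlg⟩ := hc'
  exact ⟨admissible_of_conds r hq hm4 hd heps hwin he2, chebN_ge hc,
    (lossCheb_le hq hc hZ hΛ hχ).trans_lt (hlg.trans_le (gainCheb_le r hq hR))⟩

/-- **THETA-ASSIGN (AR), RS-free and hypothesis-free for the tier-1 rows (`m = 4`)**. [this cell] -/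
theorem lossCheb_lt_gain_of_realCertCheb_four (r : Row) (hm : r.m = 4) (hq : 2 ≤ r.q) (hc : r.RealCertCheb) :
    (ofRow r).Admissible r.qn ∧ Real.exp 2 ≤ (ofRow r).chebN ∧ (ofRow r).lossCheb (1 / 2 ^ r.k) < (ofRow r).gain JSTEPS :=
  lossCheb_lt_gain_of_realCertCheb r hq hc (hm ▸ zetaHyp_four) (hm ▸ lambdaHyp_four) (chiHyp r (by omega)) (rtopHyp r (by omega))

/-- The same from a passing `checkAllCheb` list (the data modules' `_check` theorems). [this cell] -/
theorem lossCheb_lt_gain_of_checkAllCheb_four {rows : List Row} (h : checkAllCheb rows = true) (r : Row) (hr : r ∈ rows)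
    (hm : r.m = 4) (hq : 2 ≤ r.q) :
    (ofRow r).Admissible r.qn ∧ Real.exp 2 ≤ (ofRow r).chebN ∧ (ofRow r).lossCheb (1 / 2 ^ r.k) < (ofRow r).gain JSTEPS :=
  lossCheb_lt_gain_of_realCertCheb_four r hm hq (checkAllCheb_sound h r hr)

end

end Summit.RiemannHypothesis.RiemannHypothesis.Theorems.ThetaTier1
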